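import Summits.CriticalPhenomena.PercolationContinuityZ3.Theorems.PercNearOneGluingAdditiveGluingGenPair
import Literature.Probability.Percolation.KozmaNitzanSeparatingTriple
import HarnessLib

/-!
# The pocket four-point transfer for EVERY pocket family (general avoided set of the observer's pocket)

Support file (`--supports stmt-CriticalPhenomena-4575`, closed crux; independent mathematics on Kozma–Nitzan's Question 8 / the
master designation conjecture MC-D), prover `prim-ineq-gen-6` (gen 13).  No definitions, no named facts, no sorries; standard axioms.
Memo `prim-ineq-gen-6/FINDING-G13.md` §10.  Companion of `…KnQuestion8PocketFourPoint.lean` (`PocketCert.pocket_fourPoint`, the case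
`𝒟 = {W : x, y ∉ W}`) and of prim-lf-2's `…KnQuestion8PocketZFree.lean` / `…KnQuestion8PocketAttach.lean`.

Setting: one percolation `μ = prodBernoulli w`, owner `x`, observer `o`, marker `y`; a down-closed family `𝒟` of vertex sets all avoiding
`x` and `y` (the admissible POCKETS of `o`: Q8 `{W : W ∩ A = ∅}`, Q9 `{{o}}`, cuts `{W : W ∩ Z = ∅}`, size-truncated pockets, …);
`P = {C_o ∈ 𝒟}`, `E = P ∩ {x↮y}`, `O = {x↔o}`, `R = {x↮o} ∩ {x↮y} ∩ {o↔y}`, `F` monotone nonnegative, `I_S = ∫_S F(C x)`, `m = ∫ F(C x)`.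
* `PocketCert.pocket_fourPoint_family` —  `μ(R)·(μ(E)·I_P − μ(P)·I_E) ≤ μ(E)·μ(P)·(I_O − μ(O)·m)`, i.e.
  `Cov(F(C x), 1{x↔o}) ≥ μ(o↔y, y↮x) · ( E[F(C x) | P] − E[F(C x) | P, x↮y] )`  — the four-point transfer
  `AGloc.surplusTransfer_single` with the marker depression measured UNDER THE POCKET.  PROOF: exact identity with four nonnegative rows,
  `T₀ := {x↮o} ∩ {x↮y}`:
  `μ(T₀)·[μ(P)μ(E)(I_O − μ(O)m) − μ(R)(μ(E)I_P − μ(P)I_E)] = μ(T₀)μ(P)μ(E)·[I_{O∪R} − μ(O∪R)m] + μ(T₀)μ(E)μ(R)·[I_{Pᶜ} − μ(Pᶜ)m]`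
  `  + μ(P)μ(E)·[μ(R)I_{T₀} − μ(T₀)I_R] + μ(P)μ(R)·[μ(T₀)I_E − μ(E)I_{T₀}]`;
  rows 1–2 are HARRIS for the increasing events `{o↔x} ∪ {o↔y}` and `Pᶜ` (`AGloc.setIntegral_clusterFun_ge`), rows 3–4 are van den
  Berg–Häggström–Kahn's Theorem 2.1 at `q = 1` with `S = {x}`, `T = {o,y}` for the increasing functions `1{o↔y}` and `1{o↔y} ∨ 1{C_o ∉ 𝒟}` of the
  edge cluster of `T` (`BHK2006_twoSetConditionalAssociation.negCorrelation`).
Census: 0 violations in ≈ 10 000 exact-engine instances (n ≤ 8, extreme weights, 0–3 extra avoided vertices); identity verified to 1e-17.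
[cite: VandenbergHaggstromKahn2005, Thm. 2.1 (p. 9), Thm. 1.4 (p. 7), §1 p. 6] [cite: KozmaNitzan2024, Questions 8–9 (§5.5 p. 36), §5.1 (pp. 31–32)]
-/

namespace Summit.CriticalPhenomena.PercolationContinuityZ3.Theorems

open MeasureTheory Set Literature.Probability.LatticeModels Literature.Probability.Percolation
open scoped Classical
open KNPreFKG

noncomputable section

namespace PocketCert

variable {V : Type*} [Fintype V]

/-- **The pocket four-point transfer for EVERY pocket family** (the general `Z` / spectator version).  `𝒟` a down-closed
family of vertex sets all avoiding `x` and `y`, `P = {C_o ∈ 𝒟}` (so `P ⊆ {o↮x} ∩ {o↮y}`), `E = P ∩ {x↮y}`, `O = {x↔o}`,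
`R = {x↮o} ∩ {x↮y} ∩ {o↔y}`, `F` monotone nonnegative.  Then
`μ(R)·(μ(E)·∫_P F(C x) − μ(P)·∫_E F(C x)) ≤ μ(E)·μ(P)·(∫_O F(C x) − μ(O)·∫ F(C x))`, i.e.
`Cov(F(C x), 1{x↔o}) ≥ μ(o↔y, y↮x) · (E[F(C x) | P] − E[F(C x) | P ∩ {x↮y}])`.
Proof: an exact identity with FOUR nonnegative rows — Harris for `{o↔x} ∪ {o↔y}` and for `Pᶜ`, and van den Berg–Häggström–Kahn's
Thm 2.1 (`q = 1`, `S = {x}`, `T = {o,y}`) for the two increasing functions `1{o↔y}` and `1{o↔y} ∨ 1{C_o ∉ 𝒟}` of the edge cluster of `T`: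
`μ(T₀)·[μ(P)μ(E)(I_O − μ(O)m) − μ(R)(μ(E)I_P − μ(P)I_E)] = μ(T₀)μ(P)μ(E)·[I_{O∪R} − μ(O∪R)m] + μ(T₀)μ(E)μ(R)·[I_{Pᶜ} − μ(Pᶜ)m]
 + μ(P)μ(E)·[μ(R)I_{T₀} − μ(T₀)I_R] + μ(P)μ(R)·[μ(T₀)I_E − μ(E)I_{T₀}]`, `T₀ = {x↮o} ∩ {x↮y}` (memo FINDING-G13 §10).
[cite: VandenbergHaggstromKahn2005, Thm. 2.1 (p. 9), §1 p. 6] [cite: KozmaNitzan2024, Questions 8–9 (§5.5 p. 36)] -/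
theorem pocket_fourPoint_family (w : Sym2 V → unitInterval) (o x y : V) (𝒟 : Set (Set V)) (h𝒟 : IsLowerSet 𝒟)
    (hx : ∀ W ∈ 𝒟, x ∉ W) (hy : ∀ W ∈ 𝒟, y ∉ W) (F : Set V → ℝ)
    (hF : ∀ S T : Set V, S ⊆ T → F S ≤ F T) (hF0 : ∀ S, 0 ≤ F S) :
    (prodBernoulli w).real (({ω : BondConfig V | ¬ (openGraph ω).Reachable x o} ∩ {ω | ¬ (openGraph ω).Reachable x y}) ∩
          openConn o y) *
      ((prodBernoulli w).real ({ω : BondConfig V | openCluster ω o ∈ 𝒟} ∩ {ω | ¬ (openGraph ω).Reachable x y}) *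
          ∫ ω in {ω : BondConfig V | openCluster ω o ∈ 𝒟}, F (openCluster ω x) ∂(prodBernoulli w) -
        (prodBernoulli w).real {ω : BondConfig V | openCluster ω o ∈ 𝒟} *
          ∫ ω in {ω : BondConfig V | openCluster ω o ∈ 𝒟} ∩ {ω | ¬ (openGraph ω).Reachable x y},
            F (openCluster ω x) ∂(prodBernoulli w)) ≤
    (prodBernoulli w).real ({ω : BondConfig V | openCluster ω o ∈ 𝒟} ∩ {ω | ¬ (openGraph ω).Reachable x y}) *
      (prodBernoulli w).real {ω : BondConfig V | openCluster ω o ∈ 𝒟} *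
      (∫ ω in openConn x o, F (openCluster ω x) ∂(prodBernoulli w) -
        (prodBernoulli w).real (openConn x o) * ∫ ω, F (openCluster ω x) ∂(prodBernoulli w)) := by
  classical
  set μ := prodBernoulli w with hμ
  set f : BondConfig V → ℝ := fun ω => F (openCluster ω x) with hf
  have hmeas : ∀ S' : Set (BondConfig V), MeasurableSet S' := fun _ => MeasurableSet.of_discrete
  have hint : ∀ (g : BondConfig V → ℝ) (S' : Set (BondConfig V)), IntegrableOn g S' μ :=
    fun g S' => (Integrable.of_finite).integrableOn
  have hn := fun (S' : Set (BondConfig V)) => (measureReal_nonneg : 0 ≤ μ.real S')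
  -- the events
  set O : Set (BondConfig V) := openConn x o with hO
  set P : Set (BondConfig V) := {ω : BondConfig V | openCluster ω o ∈ 𝒟} with hP
  set E : Set (BondConfig V) := {ω : BondConfig V | openCluster ω o ∈ 𝒟} ∩ {ω | ¬ (openGraph ω).Reachable x y} with hE
  set T0 : Set (BondConfig V) := {ω : BondConfig V | ¬ (openGraph ω).Reachable x o} ∩ {ω | ¬ (openGraph ω).Reachable x y} with hT0
  set R : Set (BondConfig V) := ({ω : BondConfig V | ¬ (openGraph ω).Reachable x o} ∩ {ω | ¬ (openGraph ω).Reachable x y}) ∩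
      openConn o y with hR
  set U : Set (BondConfig V) := openConn o x ∪ openConn o y with hU
  set G' : Set (BondConfig V) := openConn o y ∪ Pᶜ with hG'
  set m : ℝ := ∫ ω, f ω ∂μ with hm
  -- basic facts about the pocket
  have hPox : ∀ ω ∈ P, ¬ (openGraph ω).Reachable o x := fun ω hω h => hx _ hω h
  have hPoy : ∀ ω ∈ P, ¬ (openGraph ω).Reachable o y := fun ω hω h => hy _ hω h
  -- set identities
  have hUeq : U = O ∪ R := by
    ext ω
    simp only [hU, hO, hR, mem_inter_iff, mem_union, mem_setOf_eq, openConn]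
    constructor
    · rintro (hox | hoy)
      · exact Or.inl hox.symm
      · by_cases hxo : (openGraph ω).Reachable x o
        · exact Or.inl hxo
        · exact Or.inr ⟨⟨hxo, fun hxy => hxo (hxy.trans hoy.symm)⟩, hoy⟩
    · rintro (hxo | ⟨⟨-, -⟩, hoy⟩)
      · exact Or.inl hxo.symm
      · exact Or.inr hoy
  have hdOR : Disjoint O R := by
    rw [Set.disjoint_left]
    rintro ω hxo ⟨⟨hxo', -⟩, -⟩
    exact hxo' hxo
  have hT0R : T0 ∩ openConn o y = R := rfl
  have hET0 : E ⊆ T0 := fun ω hω => ⟨fun h => hPox ω hω.1 h.symm, hω.2⟩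
  have hEP : E ⊆ P := fun ω hω => hω.1
  have hT0G : T0 ∩ G' = T0 \ E := by
    ext ω
    simp only [hG', mem_inter_iff, mem_sdiff, mem_union, mem_compl_iff, openConn]
    constructor
    · rintro ⟨ht, hg⟩
      refine ⟨ht, fun hE' => ?_⟩
      rcases hg with hoy | hnP
      · exact hPoy ω hE'.1 hoy
      · exact hnP hE'.1
    · rintro ⟨ht, hnE⟩
      refine ⟨ht, ?_⟩
      by_cases hP' : ω ∈ P
      · exact absurd ⟨hP', ht.2⟩ hnE
      · exact Or.inr hP'
  -- masses and integrals
  have eU : μ.real U = μ.real O + μ.real R := by rw [hUeq, measureReal_union hdOR (hmeas _)]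
  have iU : ∫ ω in U, f ω ∂μ = ∫ ω in O, f ω ∂μ + ∫ ω in R, f ω ∂μ := by
    rw [hUeq, setIntegral_union hdOR (hmeas _) (hint _ _) (hint _ _)]
  have ePc : μ.real Pᶜ = 1 - μ.real P := by
    have h := measureReal_add_measureReal_compl (μ := μ) (s := P) (hmeas P)
    rw [probReal_univ] at h
    linarith
  have iPc : ∫ ω in Pᶜ, f ω ∂μ = m - ∫ ω in P, f ω ∂μ := by
    have h := integral_add_compl (μ := μ) (hmeas P) (Integrable.of_finite : Integrable f μ)
    rw [hm]; linarith
  have eTE : μ.real (T0 \ E) = μ.real T0 - μ.real E := by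
    have h := measureReal_union (μ := μ) (Set.disjoint_sdiff_right : Disjoint E (T0 \ E)) (hmeas (T0 \ E))
    rw [Set.union_sdiff_cancel hET0] at h
    linarith
  have iTE : ∫ ω in T0 \ E, f ω ∂μ = (∫ ω in T0, f ω ∂μ) - ∫ ω in E, f ω ∂μ := by
    have h := setIntegral_union (μ := μ) (f := f) (Set.disjoint_sdiff_right : Disjoint E (T0 \ E)) (hmeas (T0 \ E))
      (hint _ _) (hint _ _)
    rw [Set.union_sdiff_cancel hET0] at h
    linarith
  -- (1) Harris on `U = {o↔x} ∪ {o↔y}`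
  have hH1 : μ.real U * m ≤ ∫ ω in U, f ω ∂μ :=
    AGloc.setIntegral_clusterFun_ge w x F hF hF0 U ((isUpperSet_openConn o x).union (isUpperSet_openConn o y))
  -- (2) Harris on `Pᶜ` (increasing since `𝒟` is down-closed)
  have hPc_up : IsUpperSet (Pᶜ : Set (BondConfig V)) := by
    intro ω ω' hle hω hω'
    exact hω (h𝒟 (openCluster_mono hle o) hω')
  have hH2 : μ.real Pᶜ * m ≤ ∫ ω in Pᶜ, f ω ∂μ := AGloc.setIntegral_clusterFun_ge w x F hF hF0 Pᶜ hPc_up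
  -- (3),(4) van den Berg–Häggström–Kahn Thm 2.1 for `S = {x}`, `T = {o, y}`
  set S : Set V := {x} with hS
  set T : Set V := {o, y} with hT
  set Fe : Set (Sym2 V) → ℝ := fun C => F (openCluster C x) with hFe
  set Ge : Set (Sym2 V) → ℝ := fun C => if (openGraph C).Reachable o y then 1 else 0 with hGe
  set Ge' : Set (Sym2 V) → ℝ := fun C => if (openGraph C).Reachable o y ∨ openCluster C o ∉ 𝒟 then 1 else 0 with hGe'
  have hFe_mono : Monotone Fe := fun C C' hCC' => hF _ _ (openCluster_mono hCC' x)
  have hGe_mono : Monotone Ge := by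
    intro C C' hCC'
    simp only [hGe]
    by_cases h : (openGraph C).Reachable o y
    · rw [if_pos h, if_pos (h.mono (openGraph_mono hCC'))]
    · rw [if_neg h]; split_ifs <;> norm_num
  have hGe'_mono : Monotone Ge' := by
    intro C C' hCC'
    simp only [hGe']
    by_cases h : (openGraph C).Reachable o y ∨ openCluster C o ∉ 𝒟
    · have h' : (openGraph C').Reachable o y ∨ openCluster C' o ∉ 𝒟 := by
        rcases h with h1 | h2
        · exact Or.inl (h1.mono (openGraph_mono hCC'))
        · exact Or.inr (fun hm => h2 (h𝒟 (openCluster_mono hCC' o) hm))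
      rw [if_pos h, if_pos h']
    · rw [if_neg h]; split_ifs <;> norm_num
  have hD_ST : {ω : BondConfig V | ∀ s ∈ S, ∀ t ∈ T, ¬ (openGraph ω).Reachable s t} = T0 := by
    ext ω
    simp only [hS, hT, hT0, mem_setOf_eq, mem_inter_iff, mem_insert_iff, mem_singleton_iff, forall_eq_or_imp, forall_eq]
  have hoT : o ∈ T := by simp [hT]
  have hclo : ∀ ω : BondConfig V, openCluster (⋃ t ∈ T, openEdgeCluster ω t) o = openCluster ω o := by
    intro ω; ext a; exact (KNSep.reachable_iff_cluster ω T hoT a).symm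
  have hFe_eq : ∀ ω : BondConfig V, Fe (⋃ s ∈ S, openEdgeCluster ω s) = f ω := by
    intro ω
    simp only [hFe, hf]
    congr 1
    ext a
    exact (KNSep.reachable_iff_cluster ω S (show x ∈ S by simp [hS]) a).symm
  have hGe_eq : ∀ ω : BondConfig V, Ge (⋃ t ∈ T, openEdgeCluster ω t) = (openConn o y : Set (BondConfig V)).indicator 1 ω := by
    intro ω
    simp only [hGe]
    rw [← KNSep.reachable_iff_cluster ω T hoT y]
    by_cases h : (openGraph ω).Reachable o y
    · rw [if_pos h, indicator_of_mem (show ω ∈ openConn o y from h), Pi.one_apply]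
    · rw [if_neg h, indicator_of_notMem (show ω ∉ openConn o y from h)]
  have hGe'_eq : ∀ ω : BondConfig V, Ge' (⋃ t ∈ T, openEdgeCluster ω t) = (G' : Set (BondConfig V)).indicator 1 ω := by
    intro ω
    simp only [hGe']
    rw [← KNSep.reachable_iff_cluster ω T hoT y, hclo ω]
    by_cases h : (openGraph ω).Reachable o y ∨ openCluster ω o ∉ 𝒟
    · have hmem : ω ∈ G' := by
        rcases h with h1 | h2
        · exact Or.inl h1
        · exact Or.inr h2
      rw [if_pos h, indicator_of_mem hmem, Pi.one_apply]
    · have hnmem : ω ∉ G' := by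
        rintro (h1 | h2)
        · exact h (Or.inl h1)
        · exact h (Or.inr h2)
      rw [if_neg h, indicator_of_notMem hnmem]
  have hB1 := BHK2006_twoSetConditionalAssociation.negCorrelation w S T Fe Ge hFe_mono hGe_mono
  rw [hD_ST] at hB1
  simp_rw [hFe_eq, hGe_eq] at hB1
  rw [setIntegral_mul_indicator_one μ T0 (openConn o y) f, setIntegral_indicator_one_eq μ T0 (openConn o y), hT0R] at hB1
  -- hB1 : μ T0 * ∫_R f ≤ (∫_{T0} f) * μ R
  have hB2 := BHK2006_twoSetConditionalAssociation.negCorrelation w S T Fe Ge' hFe_mono hGe'_mono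
  rw [hD_ST] at hB2
  simp_rw [hFe_eq, hGe'_eq] at hB2
  rw [setIntegral_mul_indicator_one μ T0 G' f, setIntegral_indicator_one_eq μ T0 G', hT0G, iTE, eTE] at hB2
  -- hB2 : μ T0 * (∫_{T0} f − ∫_E f) ≤ (∫_{T0} f) * (μ T0 − μ E)
  rw [iU, eU] at hH1
  rw [iPc, ePc] at hH2
  -- the four nonnegative rows
  have r1 : 0 ≤ μ.real T0 * μ.real P * μ.real E *
      ((∫ ω in O, f ω ∂μ + ∫ ω in R, f ω ∂μ) - (μ.real O + μ.real R) * m) :=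
    mul_nonneg (mul_nonneg (mul_nonneg (hn T0) (hn P)) (hn E)) (by linarith)
  have r2 : 0 ≤ μ.real T0 * μ.real E * μ.real R * ((m - ∫ ω in P, f ω ∂μ) - (1 - μ.real P) * m) :=
    mul_nonneg (mul_nonneg (mul_nonneg (hn T0) (hn E)) (hn R)) (by linarith)
  have r3 : 0 ≤ μ.real P * μ.real E * ((∫ ω in T0, f ω ∂μ) * μ.real R - μ.real T0 * ∫ ω in R, f ω ∂μ) :=
    mul_nonneg (mul_nonneg (hn P) (hn E)) (by linarith)
  have r4 : 0 ≤ μ.real P * μ.real R *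
      (μ.real T0 * (∫ ω in E, f ω ∂μ) - μ.real E * ∫ ω in T0, f ω ∂μ) :=
    mul_nonneg (mul_nonneg (hn P) (hn R)) (by nlinarith [hB2])
  have key : μ.real T0 * (μ.real E * μ.real P * ((∫ ω in O, f ω ∂μ) - μ.real O * m) -
      μ.real R * (μ.real E * (∫ ω in P, f ω ∂μ) - μ.real P * ∫ ω in E, f ω ∂μ)) =
      μ.real T0 * μ.real P * μ.real E * ((∫ ω in O, f ω ∂μ + ∫ ω in R, f ω ∂μ) - (μ.real O + μ.real R) * m) +
      μ.real T0 * μ.real E * μ.real R * ((m - ∫ ω in P, f ω ∂μ) - (1 - μ.real P) * m) +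
      μ.real P * μ.real E * ((∫ ω in T0, f ω ∂μ) * μ.real R - μ.real T0 * ∫ ω in R, f ω ∂μ) +
      μ.real P * μ.real R * (μ.real T0 * (∫ ω in E, f ω ∂μ) - μ.real E * ∫ ω in T0, f ω ∂μ) := by
    ring
  have hpos : 0 ≤ μ.real T0 * (μ.real E * μ.real P * ((∫ ω in O, f ω ∂μ) - μ.real O * m) -
      μ.real R * (μ.real E * (∫ ω in P, f ω ∂μ) - μ.real P * ∫ ω in E, f ω ∂μ)) := by
    rw [key]; exact add_nonneg (add_nonneg (add_nonneg r1 r2) r3) r4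
  by_cases hT00 : μ.real T0 = 0
  · -- then `R` and `E` are null
    have hR0 : μ.real R = 0 := le_antisymm (by rw [← hT00]; exact measureReal_mono inter_subset_left) (hn R)
    have hE0 : μ.real E = 0 := le_antisymm (by rw [← hT00]; exact measureReal_mono hET0) (hn E)
    have hgoal : μ.real R * (μ.real E * (∫ ω in P, f ω ∂μ) - μ.real P * ∫ ω in E, f ω ∂μ) ≤
        μ.real E * μ.real P * ((∫ ω in O, f ω ∂μ) - μ.real O * m) := by
      simp [hR0, hE0]
    exact hgoal
  · have hTpos : 0 < μ.real T0 := lt_of_le_of_ne (hn T0) (Ne.symm hT00)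
    have hX : 0 ≤ μ.real E * μ.real P * ((∫ ω in O, f ω ∂μ) - μ.real O * m) -
        μ.real R * (μ.real E * (∫ ω in P, f ω ∂μ) - μ.real P * ∫ ω in E, f ω ∂μ) :=
      (mul_nonneg_iff_of_pos_left hTpos).1 hpos
    have hgoal : μ.real R * (μ.real E * (∫ ω in P, f ω ∂μ) - μ.real P * ∫ ω in E, f ω ∂μ) ≤
        μ.real E * μ.real P * ((∫ ω in O, f ω ∂μ) - μ.real O * m) := sub_nonneg.1 hX
    exact hgoal

end PocketCert

end

end Summit.CriticalPhenomena.PercolationContinuityZ3.Theorems
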